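import Literature.NumberTheory.NumberFields.ClassGroupCertDK
import Mathlib.RingTheory.DedekindDomain.Factorization
import Mathlib.RingTheory.DedekindDomain.AdicValuation
import Mathlib.Data.Nat.Factorization.Basic
import HarnessLib

/-!
# BirchSwinnertonDyer — rank ≥ 2 observatory: valuation certificates for the class-group-general 2-descent (KERNEL-2DESC-CL, N5)

HONEST FRAMING: per-curve certified theorems and census instruments; no claim on BSD in rank ≥ 2.

Generic file N5 of the class-group-general cubic-field `2`-descent (design
`b2b-bsdr2-cert-1/KERNEL-2DESC-CL.md`). The valuation-parity rows of the sieve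
(`Rank2Observatory2DescClVCover.valRow_sound`) and the `T`-unit family need, for explicit algebraic
integers `x` and explicit primes `w`, the exact value of `ord_w(x)`. Two kernel-checkable
certificates, valid in the ring of integers of any number field:

* **non-membership from an inverse**: `x·y − 1 ∈ w ⟹ x ∉ w`, i.e. `ord_w(x) = 0`
  (`not_mem_of_mul_sub_one_mem`, `log_valuation_eq_zero_of_mul_sub_one_mem`) — the membership of
  `x y − 1` in an ideal `(p, G(θ)) ⊆ w` is a ring identity;
* **the norm identity at a rational prime `p`**: if `U` contains every prime `∋ p` and
  `N(u) = p^{f_u}` on `U`, then `∑_{u ∈ U} f_u · log v_u(x) = −v_p(|N_{K/ℚ}(x)|)`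
  (`sum_mul_log_valuation_eq`; ideal factorisation of `(x)` and multiplicativity of the absolute
  norm), with the two corollaries used by the certificates: the **single-prime squeeze**
  (`log_valuation_eq_of_forall_not_mem`: `x` outside the other primes above `p` and
  `|N(x)| = p^{f_w e}·m`, `p ∤ m` ⟹ `ord_w(x) = e`) and the **`(1)(2)` prime**
  (`log_valuation_eq_neg_one_of_one_two`: `|N(x)| = p³·m`, `x` in both primes above `p` of degrees
  `1, 2` ⟹ both orders are `1`).
[cite: Marcus2018, Ch. 3, Thm. 22 (norm of an ideal is multiplicative; `N((x)) = |N(x)|`)]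
[cite: Cohen1993, §4.8.3 (valuations at prime ideals from norms)]

## References
* D. A. Marcus, *Number Fields*, 2nd ed. (2018), Ch. 3, Thm. 22. [Marcus2018]
* H. Cohen, *A Course in Computational Algebraic Number Theory*, GTM 138 (1993), §4.8.
  [Cohen1993]
-/

-- single-conjunct summit: `Summit.BirchSwinnertonDyer.BirchSwinnertonDyer.…` repeats the name by design
set_option linter.dupNamespace false

noncomputable section

open scoped Classical NumberField nonZeroDivisors

namespace Summit.BirchSwinnertonDyer.BirchSwinnertonDyer.Rank2Observatory.TwoDescCl

open IsDedekindDomain IsDedekindDomain.HeightOneSpectrum NumberField Ideal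
open Literature.NumberTheory.NumberFields

variable {K : Type*} [Field K] [NumberField K]

/-! ## Non-membership from an inverse -/

omit [NumberField K] in
/-- `x · y − 1 ∈ w ⟹ x ∉ w` (`w` proper). [folklore] -/
theorem not_mem_of_mul_sub_one_mem (w : HeightOneSpectrum (𝓞 K)) {x y : 𝓞 K}
    (h : x * y - 1 ∈ w.asIdeal) : x ∉ w.asIdeal := by
  intro hx
  have h1 : x * y - (x * y - 1) ∈ w.asIdeal := sub_mem (Ideal.mul_mem_right _ _ hx) h
  rw [sub_sub_cancel] at h1
  exact w.isPrime.ne_top ((Ideal.eq_top_iff_one _).mpr h1)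

/-- `x · y − 1 ∈ w ⟹ v_w(x) = 1`. [folklore] -/
theorem valuation_eq_one_of_mul_sub_one_mem (w : HeightOneSpectrum (𝓞 K)) {x y : 𝓞 K}
    (h : x * y - 1 ∈ w.asIdeal) : w.valuation K (x : K) = 1 := by
  rw [RingOfIntegers.coe_eq_algebraMap]
  exact (valuation_eq_one_iff_notMem (v := w) (K := K)).mpr (not_mem_of_mul_sub_one_mem w h)

/-- `x · y − 1 ∈ w ⟹ log v_w(x) = 0`. [folklore] -/
theorem log_valuation_eq_zero_of_mul_sub_one_mem (w : HeightOneSpectrum (𝓞 K)) {x y : 𝓞 K}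
    (h : x * y - 1 ∈ w.asIdeal) : WithZero.log (w.valuation K (x : K)) = 0 := by
  rw [valuation_eq_one_of_mul_sub_one_mem w h, WithZero.log_one]

/-! ## Primes dividing the norm of a prime ideal -/

omit [NumberField K] in
/-- A prime ideal containing (the image of) a natural number `n ≠ 0` contains one of its prime
factors. [folklore] -/
theorem exists_prime_natCast_mem (w : HeightOneSpectrum (𝓞 K)) {n : ℕ} (hn : n ≠ 0)
    (h : (n : 𝓞 K) ∈ w.asIdeal) : ∃ q : ℕ, q.Prime ∧ (q : 𝓞 K) ∈ w.asIdeal := by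
  have key : ∀ L : List ℕ, (∀ q ∈ L, q.Prime) → ((L.prod : ℕ) : 𝓞 K) ∈ w.asIdeal →
      ∃ q : ℕ, q.Prime ∧ (q : 𝓞 K) ∈ w.asIdeal := by
    intro L
    induction L with
    | nil =>
      intro _ h1
      rw [List.prod_nil, Nat.cast_one] at h1
      exact absurd ((Ideal.eq_top_iff_one _).mpr h1) w.isPrime.ne_top
    | cons q L ih =>
      intro hL h1
      rw [List.prod_cons, Nat.cast_mul] at h1
      rcases w.isPrime.mem_or_mem h1 with h2 | h2
      · exact ⟨q, hL q List.mem_cons_self, h2⟩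
      · exact ih (fun q' hq' => hL q' (List.mem_cons_of_mem q hq')) h2
  exact key n.primeFactorsList (fun q hq => Nat.prime_of_mem_primeFactorsList hq)
    (by rwa [Nat.prod_primeFactorsList hn])

/-- **`p ∣ N(w) ⟹ p ∈ w`** for a prime ideal `w` and a rational prime `p` (the norm of `w` is a
power of the prime below it). [cite: Marcus2018, Ch. 3, Thm. 22] -/
theorem natCast_mem_of_dvd_absNorm (w : HeightOneSpectrum (𝓞 K)) {p : ℕ} (hp : p.Prime)
    (h : p ∣ absNorm w.asIdeal) : (p : 𝓞 K) ∈ w.asIdeal := by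
  have hn : absNorm w.asIdeal ≠ 0 := fun h0 => w.ne_bot (absNorm_eq_zero_iff.mp h0)
  obtain ⟨q, hq, hqw⟩ := exists_prime_natCast_mem w hn (Ideal.absNorm_mem w.asIdeal)
  have hover := MonicCubic.mem_primesOver_of_mem w.isPrime hq hqw
  haveI := w.isPrime
  haveI := hover.2
  have hpow : q ^ w.asIdeal.inertiaDeg ℤ = absNorm w.asIdeal := Ideal.pow_inertiaDeg q w.asIdeal
  rw [← hpow] at h
  have hpq : p = q := (Nat.prime_dvd_prime_iff_eq hp hq).mp (hp.dvd_of_dvd_pow h)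
  rw [hpq]; exact hqw

/-! ## The norm identity -/

/-- **The norm identity at `p`.** If the finite set `U` of primes contains every prime `∋ p` and
`N(u) = p^{f u}` for `u ∈ U`, then for `x ≠ 0` in `𝓞 K`,
`∑_{u ∈ U} f_u · log v_u(x) = − v_p(|N_{K/ℚ}(x)|)` (so `∑ f_u ord_u(x) = v_p|N(x)|`).
[cite: Marcus2018, Ch. 3, Thm. 22] -/
theorem sum_mul_log_valuation_eq {p : ℕ} (hp : p.Prime) (U : Finset (HeightOneSpectrum (𝓞 K)))
    (hU : ∀ u : HeightOneSpectrum (𝓞 K), (p : 𝓞 K) ∈ u.asIdeal → u ∈ U)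
    (f : HeightOneSpectrum (𝓞 K) → ℕ) (hf : ∀ u ∈ U, absNorm u.asIdeal = p ^ f u)
    {x : 𝓞 K} (hx : x ≠ 0) :
    ∑ u ∈ U, (f u : ℤ) * WithZero.log (u.valuation K (x : K)) =
      -(((Algebra.norm ℤ x).natAbs.factorization p : ℕ) : ℤ) := by
  set I : Ideal (𝓞 K) := span {x} with hIdef
  have hI : I ≠ ⊥ := by rw [hIdef, Ne, span_singleton_eq_bot]; exact hx
  -- the exponents of the factorisation of `(x)` and the valuations
  set c : HeightOneSpectrum (𝓞 K) → ℕ := fun v =>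
    (Associates.mk v.asIdeal).count (Associates.mk I).factors with hcdef
  have hval : ∀ v : HeightOneSpectrum (𝓞 K), WithZero.log (v.valuation K (x : K)) = -(c v : ℤ) := by
    intro v
    rw [RingOfIntegers.coe_eq_algebraMap, valuation_of_algebraMap, intValuation_if_neg v hx,
      WithZero.log_exp]
  -- `|N(x)| = ∏_{v ∈ S} N(v)^{c v}` over the support `S` of the factorisation
  have hS := Ideal.hasFiniteMulSupport hI
  set S := hS.toFinset with hSdef
  have hprod : ∏ v ∈ S, v.maxPowDividing I = I := by
    rw [← finprod_eq_prod_of_mulSupport_toFinset_subset _ hS subset_rfl]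
    exact finprod_heightOneSpectrum_factorization hI
  have hnorm : (Algebra.norm ℤ x).natAbs = ∏ v ∈ S, absNorm v.asIdeal ^ c v := by
    rw [← absNorm_span_singleton, ← hIdef, ← hprod, map_prod]
    refine Finset.prod_congr rfl fun v _ => ?_
    rw [maxPowDividing, map_pow]
  have hne : ∀ v ∈ S, absNorm v.asIdeal ^ c v ≠ 0 := fun v _ =>
    pow_ne_zero _ fun h0 => v.ne_bot (absNorm_eq_zero_iff.mp h0)
  have hfac : (Algebra.norm ℤ x).natAbs.factorization p =
      ∑ v ∈ S, c v * (absNorm v.asIdeal).factorization p := by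
    rw [hnorm, Nat.factorization_prod hne, Finsupp.coe_finsetSum, Finset.sum_apply]
    refine Finset.sum_congr rfl fun v _ => ?_
    rw [Nat.factorization_pow, Finsupp.coe_smul, Pi.smul_apply, smul_eq_mul]
  -- terms off `U` vanish (`p ∉ v ⟹ p ∤ N(v)`), terms off `S` vanish (`c v = 0`)
  set g : HeightOneSpectrum (𝓞 K) → ℕ := fun v => c v * (absNorm v.asIdeal).factorization p
    with hgdef
  have hgU : ∀ v, v ∉ U → g v = 0 := by
    intro v hv
    have hpv : (p : 𝓞 K) ∉ v.asIdeal := fun h => hv (hU v h)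
    have hndvd : ¬ p ∣ absNorm v.asIdeal := fun h => hpv (natCast_mem_of_dvd_absNorm v hp h)
    simp only [hgdef, Nat.factorization_eq_zero_of_not_dvd hndvd, mul_zero]
  have hcS : ∀ v, v ∉ S → c v = 0 := by
    intro v hv
    rw [hSdef, Set.Finite.mem_toFinset, Function.mem_mulSupport, not_not, maxPowDividing] at hv
    by_contra hc
    have hlt : v.asIdeal ^ c v ≤ v.asIdeal := Ideal.pow_le_self hc
    rw [hv, Ideal.one_eq_top, top_le_iff] at hlt
    exact v.isPrime.ne_top hlt
  have h1 : ∑ v ∈ S, g v = ∑ v ∈ S ∪ U, g v :=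
    Finset.sum_subset Finset.subset_union_left fun v _ hvS => by
      simp only [hgdef, hcS v hvS, zero_mul]
  have h2 : ∑ v ∈ U, c v * f v = ∑ v ∈ S ∪ U, g v := by
    rw [← Finset.sum_subset Finset.subset_union_right fun v _ hvU => hgU v hvU]
    refine Finset.sum_congr rfl fun v hv => ?_
    simp only [hgdef, hf v hv, hp.factorization_pow, Finsupp.single_eq_same]
  have hkey : (Algebra.norm ℤ x).natAbs.factorization p = ∑ v ∈ U, c v * f v := by
    rw [hfac]; exact h1.trans h2.symm
  rw [hkey]
  push_cast
  rw [← Finset.sum_neg_distrib]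
  refine Finset.sum_congr rfl fun v _ => ?_
  rw [hval v]; ring

/-- `v_p(p^{k} · m) = k` for `p ∤ m`. [folklore] -/
theorem factorization_pow_mul_eq {p k m : ℕ} (hp : p.Prime) (hm : ¬ p ∣ m) :
    (p ^ k * m).factorization p = k := by
  have hm0 : m ≠ 0 := by rintro rfl; exact hm (dvd_zero p)
  rw [Nat.factorization_mul (pow_ne_zero _ hp.ne_zero) hm0, Finsupp.coe_add, Pi.add_apply,
    hp.factorization_pow, Finsupp.single_eq_same, Nat.factorization_eq_zero_of_not_dvd hm, add_zero]

/-- **Single-prime squeeze.** With `U`, `f` as in `sum_mul_log_valuation_eq`, `w ∈ U` with `f w > 0`,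
`x` outside every other prime of `U`, and `|N(x)| = p^{f_w · e} · m` with `p ∤ m`:
`log v_w(x) = −e`, i.e. `ord_w(x) = e`. [cite: Cohen1993, §4.8.3] -/
theorem log_valuation_eq_of_forall_not_mem {p : ℕ} (hp : p.Prime)
    (U : Finset (HeightOneSpectrum (𝓞 K)))
    (hU : ∀ u : HeightOneSpectrum (𝓞 K), (p : 𝓞 K) ∈ u.asIdeal → u ∈ U)
    (f : HeightOneSpectrum (𝓞 K) → ℕ) (hf : ∀ u ∈ U, absNorm u.asIdeal = p ^ f u)
    {w : HeightOneSpectrum (𝓞 K)} (hw : w ∈ U) (hfw : 0 < f w) {x : 𝓞 K}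
    (hothers : ∀ u ∈ U, u ≠ w → x ∉ u.asIdeal) {e m : ℕ}
    (hN : (Algebra.norm ℤ x).natAbs = p ^ (f w * e) * m) (hm : ¬ p ∣ m) :
    WithZero.log (w.valuation K (x : K)) = -(e : ℤ) := by
  have hm0 : m ≠ 0 := by rintro rfl; exact hm (dvd_zero p)
  have hx : x ≠ 0 := by
    rintro rfl
    rw [Algebra.norm_zero, Int.natAbs_zero] at hN
    exact (mul_ne_zero (pow_ne_zero _ hp.ne_zero) hm0) hN.symm
  have h := sum_mul_log_valuation_eq hp U hU f hf hx
  rw [hN, factorization_pow_mul_eq hp hm, ← Finset.add_sum_erase U _ hw,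
    Finset.sum_eq_zero (s := U.erase w)] at h
  · push_cast at h
    rw [add_zero] at h
    have hf0 : (f w : ℤ) ≠ 0 := by exact_mod_cast hfw.ne'
    refine mul_left_cancel₀ hf0 ?_
    rw [h]; ring
  · intro u hu
    obtain ⟨hne, huU⟩ := Finset.mem_erase.mp hu
    have h1 : u.valuation K (x : K) = 1 := by
      rw [RingOfIntegers.coe_eq_algebraMap]
      exact (valuation_eq_one_iff_notMem (v := u) (K := K)).mpr (hothers u huU hne)
    rw [h1, WithZero.log_one, mul_zero]

/-- **The `(1)(2)` prime.** If the primes above `p` are `w₁ ≠ w₂` of degrees `1, 2`, and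
`x ∈ w₁ ∩ w₂` has `|N(x)| = p³ · m` with `p ∤ m` (e.g. `x = p`), then `ord_{w₁}(x) = ord_{w₂}(x) = 1`.
[cite: Marcus2018, Ch. 3, Thm. 22] -/
theorem log_valuation_eq_neg_one_of_one_two {p : ℕ} (hp : p.Prime)
    {w₁ w₂ : HeightOneSpectrum (𝓞 K)} (hne : w₁ ≠ w₂)
    (hU : ∀ u : HeightOneSpectrum (𝓞 K), (p : 𝓞 K) ∈ u.asIdeal → u = w₁ ∨ u = w₂)
    (h₁ : absNorm w₁.asIdeal = p) (h₂ : absNorm w₂.asIdeal = p ^ 2) {x : 𝓞 K}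
    (hx₁ : x ∈ w₁.asIdeal) (hx₂ : x ∈ w₂.asIdeal) {m : ℕ}
    (hN : (Algebra.norm ℤ x).natAbs = p ^ 3 * m) (hm : ¬ p ∣ m) :
    WithZero.log (w₁.valuation K (x : K)) = -1 ∧ WithZero.log (w₂.valuation K (x : K)) = -1 := by
  have hm0 : m ≠ 0 := by rintro rfl; exact hm (dvd_zero p)
  have hx : x ≠ 0 := by
    rintro rfl
    rw [Algebra.norm_zero, Int.natAbs_zero] at hN
    exact (mul_ne_zero (pow_ne_zero _ hp.ne_zero) hm0) hN.symm
  let f : HeightOneSpectrum (𝓞 K) → ℕ := fun u => if u = w₁ then 1 else 2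
  have hf : ∀ u ∈ ({w₁, w₂} : Finset (HeightOneSpectrum (𝓞 K))), absNorm u.asIdeal = p ^ f u := by
    intro u hu
    rcases Finset.mem_insert.mp hu with rfl | hu
    · simp [f, h₁]
    · rw [Finset.mem_singleton] at hu
      subst hu
      simp [f, if_neg hne.symm, h₂]
  have h := sum_mul_log_valuation_eq hp {w₁, w₂}
    (fun u hu => by
      rcases hU u hu with rfl | rfl
      · exact Finset.mem_insert_self _ _
      · exact Finset.mem_insert_of_mem (Finset.mem_singleton_self _)) f hf hx
  rw [Finset.sum_pair hne, hN, factorization_pow_mul_eq hp hm] at h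
  simp only [f, if_pos rfl, if_neg hne.symm] at h
  push_cast at h
  -- both logs are `≤ -1`
  have hlt : ∀ {w : HeightOneSpectrum (𝓞 K)}, x ∈ w.asIdeal →
      WithZero.log (w.valuation K (x : K)) ≤ -1 := by
    intro w hxw
    have hv : w.valuation K (x : K) < 1 := by
      rw [RingOfIntegers.coe_eq_algebraMap]; exact (valuation_lt_one_iff_mem (v := w) (K := K) x).mpr hxw
    have hv0 : w.valuation K (x : K) ≠ 0 :=
      (Valuation.ne_zero_iff _).mpr (RingOfIntegers.coe_ne_zero_iff.mpr hx)
    have := (WithZero.log_lt_iff_lt_exp hv0).mpr (by rwa [WithZero.exp_zero])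
    omega
  have hl₁ := hlt hx₁
  have hl₂ := hlt hx₂
  constructor <;> omega

end Summit.BirchSwinnertonDyer.BirchSwinnertonDyer.Rank2Observatory.TwoDescCl

end
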